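import Mathlib
import HarnessLib
import Summits.Ventures.LatticeQCDFlow.Exactness.SUNLeapfrogHMCEngine
import Summits.Ventures.LatticeQCDFlow.Exactness.TransformedKernelConvergence

/-!
# Field-transformed (trivializing-map) single-step leapfrog HMC on `SU(N)` lattice gauge fields is uniformly ergodic

HONEST FRAMING: exact (Metropolis-corrected) sampling algorithms for lattice gauge theory;
figures of merit are autocorrelation/cost numbers at stated couplings and volumes; no
continuum-physics claim.

Venture `LatticeQCDFlow` (cell pub-lqcd), topic `Exactness`, FANOUT row 9 (eng-latcore; the
kernels concerned are `latflow.core.hmc` on `SU(N)` and the field-transformed HMC of family B /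
rows 14, 23–26 — Lüscher 2010: run HMC for `H̃(V, π) = S(F V) − log J(V) + T(π)` and REPORT
`U = F V`).  NEW WORK of the cell over the tree (`SUNLeapfrogHMCErgodic.lean` /
`SUNLeapfrogHMCEngine.lean`: a power of single-step leapfrog HMC on `SU(N)^links` is Doeblin for ANY
bounded measurable action; `TransformedKernel.lean` / `MomentumRefresh.lean`: `conjKernel`,
`conjKernel_nHit`, `thmc_config_exact`; `TransformedKernelConvergence.conjKernel_minorised`;
`MetropolisSweepConvergence.uniformlyErgodic_of_nHit_minorised`; `DoeblinUniqueness.lean`); nothing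
here is cited as a fact.  Printed counterparts, named only: Lüscher 2010 (trivializing maps),
Duane–Kennedy–Pendleton–Roweth 1987.  The `SU(N)` twin of `SU2LeapfrogFTHMCErgodic.lean`.

THE POINT.  A Doeblin minorant of a POWER of the kernel is still a statement from every state, so it
passes through the measurable re-labelling `F` (`conjKernel_minorised` + `conjKernel_nHit`); the
modified action `S∘F − log J` is bounded and measurable when `S` is and `J` is pinched; and
`thmc_config_exact` says the reported kernel's invariant law is `e^{−S}·Haar^{⊗links}`.

* `abs_modifiedAction_le`, `measurable_modifiedAction` (any configuration space);
* `sunLeapfrogFTHMC_invariant` / `_invariant_gibbs` — the reported kernel is EXACT for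
  `e^{−S}·Haar^{⊗links}`;
* **`sunLeapfrogFTHMC_nHit_minorised`** — a power of the reported kernel dominates
  `δ · F_* Haar^{⊗links}` from every start;
* **`sunLeapfrogFTHMC_uniformlyErgodic`** — coordinates `ι` injective onto `𝔰𝔲(N)` (`N ≥ 1`), any
  additive Haar `μ`, measurable kinetic term `T ≥ 0` bounded on boxes with `Z_T < ∞`, `ε > 0`,
  measurable momentum increment `|g| ≤ b`, measurable action `|S| ≤ s`, measurable equivalence `F`
  with `HasJacobian Haar^⊗ F J`, `0 < j₁ ≤ J ≤ j₂` measurable: `|μ₀K̃ᵗ(A) − π_S(A)| ≤ (1 − δ)^{⌊t/(k+1)⌋}`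
  for EVERY initial law (`π_S = gibbsProbability Haar^⊗ e^{−S}`); **`sunLeapfrogFTHMC_invariant_unique`**;
* **`engine_sunLeapfrogFTHMC_uniformlyErgodic`**, **`engine_sunLeapfrogFTHMC_invariant_unique`** — the
  engine's coordinates and kinetic term `−Σ tr P²` (`SUNLeapfrogHMCEngine.lean`): field-transformed
  nstep = 1 HMC on `SU(N)` reported through any such `F` converges to `Z_S⁻¹e^{−S}·Haar^⊗` from every
  start, unique invariant law, every `N ≥ 1`.

NOT CLAIMED: `nstep ≥ 2`, OMF words, `tau_jitter`; any usable constant; floating point; which maps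
`F` the engine certifies (rows 14 / 23–26 type their members' Jacobians).
-/

noncomputable section

namespace Summit.Ventures.LatticeQCDFlow.Exactness

open MeasureTheory ProbabilityTheory ProbabilityTheory.Kernel Set Metric Function NormedSpace Filter Topology
open Literature.MathematicalPhysics.QuantumFieldTheory (haarProbability)
open scoped ENNReal Matrix NNReal

/-! ## §1 The modified action is bounded and measurable -/

section Modified

variable {Ω : Type*} [MeasurableSpace Ω] {S : Ω → ℝ} {s : ℝ} {F : Ω ≃ᵐ Ω} {J : Ω → ℝ} {j₁ j₂ : ℝ}

/-- **The modified action `S∘F − log J` is bounded** when `|S| ≤ s` and `0 < j₁ ≤ J ≤ j₂`: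
`|S(F v) − log J(v)| ≤ s + (|log j₁| + |log j₂|)`. -/
theorem abs_modifiedAction_le (hs : ∀ u, |S u| ≤ s) (hj₁ : 0 < j₁) (hJ₁ : ∀ v, j₁ ≤ J v)
    (hJ₂ : ∀ v, J v ≤ j₂) (v : Ω) : |S (F v) - Real.log (J v)| ≤ s + (|Real.log j₁| + |Real.log j₂|) := by
  have hJpos : 0 < J v := hj₁.trans_le (hJ₁ v)
  have hlo : Real.log j₁ ≤ Real.log (J v) := Real.log_le_log hj₁ (hJ₁ v)
  have hhi : Real.log (J v) ≤ Real.log j₂ := Real.log_le_log hJpos (hJ₂ v)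
  have hlog : |Real.log (J v)| ≤ |Real.log j₁| + |Real.log j₂| := by
    rcases le_or_gt 0 (Real.log (J v)) with h | h
    · rw [abs_of_nonneg h]
      exact (hhi.trans (le_abs_self _)).trans (le_add_of_nonneg_left (abs_nonneg _))
    · rw [abs_of_neg h]
      exact ((neg_le_neg hlo).trans (neg_le_abs _)).trans (le_add_of_nonneg_right (abs_nonneg _))
  calc |S (F v) - Real.log (J v)| ≤ |S (F v)| + |Real.log (J v)| := abs_sub _ _
    _ ≤ s + (|Real.log j₁| + |Real.log j₂|) := add_le_add (hs _) hlog

/-- The modified action is measurable. -/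
theorem measurable_modifiedAction (hS : Measurable S) (hJm : Measurable J) :
    Measurable fun v : Ω => S (F v) - Real.log (J v) :=
  (hS.comp F.measurable).sub (Real.measurable_log.comp hJm)

end Modified

/-! ## §2 The reported kernel: exactness, a Doeblin power, uniform ergodicity, uniqueness -/

section FTHMC

variable {n : Type*} [Fintype n] [DecidableEq n]
variable {E : Type*} [NormedAddCommGroup E] [NormedSpace ℝ E] [MeasurableSpace E] [BorelSpace E]
  [FiniteDimensional ℝ E]
variable (ι : E →ₗ[ℝ] Matrix n n ℂ) (hι : ∀ a, (ι a)ᴴ = -ι a ∧ (ι a).trace = 0)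
variable {L : Type*} [Fintype L] (μ : Measure E) [μ.IsAddHaarMeasure]
variable {T : (L → E) → ℝ} {τ : ℝ → ℝ} {ε : ℝ} {g : (L → Matrix.specialUnitaryGroup n ℂ) → L → E}
  {S : (L → Matrix.specialUnitaryGroup n ℂ) → ℝ} {s : ℝ}
  {F : (L → Matrix.specialUnitaryGroup n ℂ) ≃ᵐ (L → Matrix.specialUnitaryGroup n ℂ)}
  {J : (L → Matrix.specialUnitaryGroup n ℂ) → ℝ} {j₁ j₂ : ℝ}

/-- **The reported FT-HMC kernel is exact**: single-step leapfrog HMC for the modified action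
`S∘F − log J`, reported through `F`, leaves `e^{−S}·Haar^{⊗links}` invariant (`thmc_config_exact`). -/
theorem sunLeapfrogFTHMC_invariant (hg : Measurable g) (hT : Measurable T)
    (hZ : sunMomentumWeight (L := L) μ T univ ≠ ⊤) (hJ : ∀ v, 0 < J v) (hJm : Measurable J)
    (hF : HasJacobian (Measure.pi fun _ : L => haarProbability (Matrix.specialUnitaryGroup n ℂ)) F
      fun v => ENNReal.ofReal (J v))
    (hS : Measurable S) :
    Invariant (conjKernel (sunLeapfrogHMC ι hι μ T ε hg fun v => S (F v) - Real.log (J v)) F)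
      ((Measure.pi fun _ : L => haarProbability (Matrix.specialUnitaryGroup n ℂ)).withDensity
        fun u => ENNReal.ofReal (Real.exp (-S u))) :=
  thmc_config_exact (vol := Measure.pi fun _ : L => haarProbability (Matrix.specialUnitaryGroup n ℂ))
    (volP := Measure.pi fun _ : L => μ) (hΦ := measurable_sunLeapfrogProposal ι hι ε hg) hJ hJm hF hS hT
    (involutive_sunLeapfrogProposal ι hι ε g) (measurePreserving_sunLeapfrogProposal ι hι μ ε hg)
    (sunMomentumWeight_univ_ne_zero μ T hT) hZ

/-- … and the normalised Gibbs law is invariant. -/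
theorem sunLeapfrogFTHMC_invariant_gibbs (hg : Measurable g) (hT : Measurable T)
    (hZ : sunMomentumWeight (L := L) μ T univ ≠ ⊤) (hJ : ∀ v, 0 < J v) (hJm : Measurable J)
    (hF : HasJacobian (Measure.pi fun _ : L => haarProbability (Matrix.specialUnitaryGroup n ℂ)) F
      fun v => ENNReal.ofReal (J v))
    (hS : Measurable S) :
    Invariant (conjKernel (sunLeapfrogHMC ι hι μ T ε hg fun v => S (F v) - Real.log (J v)) F)
      (gibbsProbability (Measure.pi fun _ : L => haarProbability (Matrix.specialUnitaryGroup n ℂ))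
        fun u => Real.exp (-S u)) :=
  invariant_gibbsProbability (sunLeapfrogFTHMC_invariant ι hι μ hg hT hZ hJ hJm hF hS)

/-- **A POWER OF THE REPORTED KERNEL IS DOEBLIN**: `K̃^{k+1}(x, ·) ≥ δ · F_* Haar^{⊗links}` from every
`x` (the `V`-chain's Doeblin power passes through `F`: `conjKernel_minorised`, `conjKernel_nHit`). -/
theorem sunLeapfrogFTHMC_nHit_minorised [Nonempty n] (hinj : Injective ι)
    (hsurj : ∀ X : Matrix n n ℂ, Xᴴ = -X → X.trace = 0 → X ∈ LinearMap.range ι)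
    (hε : 0 < ε) (hT : Measurable T) (hT0 : ∀ p, 0 ≤ T p)
    (hTle : ∀ (R : ℝ) (p : L → E), (∀ l, ‖p l‖ ≤ R) → T p ≤ τ R) (hZ : sunMomentumWeight (L := L) μ T univ ≠ ⊤)
    (hg : Measurable g) {b : ℝ} (hb0 : 0 ≤ b) (hb : ∀ u l, ‖g u l‖ ≤ b)
    (hS : Measurable S) (hs : ∀ u, |S u| ≤ s)
    (hj₁ : 0 < j₁) (hJ₁ : ∀ v, j₁ ≤ J v) (hJ₂ : ∀ v, J v ≤ j₂) (hJm : Measurable J) :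
    ∃ k : ℕ, ∃ δ : ℝ≥0∞, 0 < δ ∧ ∀ x,
      δ • (Measure.pi fun _ : L => haarProbability (Matrix.specialUnitaryGroup n ℂ)).map F ≤
        nHit (conjKernel (sunLeapfrogHMC ι hι μ T ε hg fun v => S (F v) - Real.log (J v)) F) (k + 1) x := by
  obtain ⟨k, δ, hδ, hmin⟩ := sunLeapfrogHMC_nHit_minorised ι hι μ (τ := τ) hinj hsurj hε hT hT0 hTle hZ hg hb0 hb
    (measurable_modifiedAction hS hJm) (abs_modifiedAction_le (F := F) hs hj₁ hJ₁ hJ₂)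
  refine ⟨k, δ, hδ, fun x => ?_⟩
  rw [← conjKernel_nHit]
  exact conjKernel_minorised hmin F x

/-- **FIELD-TRANSFORMED SINGLE-STEP LEAPFROG HMC ON `SU(N)^links` IS UNIFORMLY ERGODIC**: with the
hypotheses of `sunLeapfrogFTHMC_nHit_minorised` and `HasJacobian Haar^⊗ F J`, there are `k` and
`δ ∈ (0, 1]` with `|μ₀K̃ᵗ(A) − π_S(A)| ≤ (1 − δ)^{⌊t/(k+1)⌋}` for EVERY initial law `μ₀`, every `t`,
every `A` (`π_S = gibbsProbability Haar^⊗ e^{−S}`, `K̃` the reported kernel). -/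
theorem sunLeapfrogFTHMC_uniformlyErgodic [Nonempty n] (hinj : Injective ι)
    (hsurj : ∀ X : Matrix n n ℂ, Xᴴ = -X → X.trace = 0 → X ∈ LinearMap.range ι)
    (hε : 0 < ε) (hT : Measurable T) (hT0 : ∀ p, 0 ≤ T p)
    (hTle : ∀ (R : ℝ) (p : L → E), (∀ l, ‖p l‖ ≤ R) → T p ≤ τ R) (hZ : sunMomentumWeight (L := L) μ T univ ≠ ⊤)
    (hg : Measurable g) {b : ℝ} (hb0 : 0 ≤ b) (hb : ∀ u l, ‖g u l‖ ≤ b)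
    (hS : Measurable S) (hs : ∀ u, |S u| ≤ s)
    (hj₁ : 0 < j₁) (hJ₁ : ∀ v, j₁ ≤ J v) (hJ₂ : ∀ v, J v ≤ j₂) (hJm : Measurable J)
    (hF : HasJacobian (Measure.pi fun _ : L => haarProbability (Matrix.specialUnitaryGroup n ℂ)) F
      fun v => ENNReal.ofReal (J v)) :
    ∃ k : ℕ, ∃ δ : ℝ, 0 < δ ∧ δ ≤ 1 ∧ ∀ (μ₀ : Measure (L → Matrix.specialUnitaryGroup n ℂ))
      [IsProbabilityMeasure μ₀] (t : ℕ) (A : Set (L → Matrix.specialUnitaryGroup n ℂ)),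
      |((fun m : Measure (L → Matrix.specialUnitaryGroup n ℂ) =>
            m.bind (conjKernel (sunLeapfrogHMC ι hι μ T ε hg fun v => S (F v) - Real.log (J v)) F))^[t] μ₀).real A
          - (gibbsProbability (Measure.pi fun _ : L => haarProbability (Matrix.specialUnitaryGroup n ℂ))
              (fun u => Real.exp (-S u))).real A| ≤ (1 - δ) ^ (t / (k + 1)) := by
  obtain ⟨hlo, hhi⟩ := gibbsWeight_pinched (L := L) (n := n) hs
  haveI := isProbabilityMeasure_gibbsProbability
    (μ := Measure.pi fun _ : L => haarProbability (Matrix.specialUnitaryGroup n ℂ)) (Real.exp_pos (-s)) hlo hhi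
  haveI := isProbabilityMeasure_sunMomentumLaw (L := L) μ T hT hZ
  have hJ : ∀ v, 0 < J v := fun v => hj₁.trans_le (hJ₁ v)
  have hSt := measurable_modifiedAction (F := F) hS hJm
  have hH : Measurable fun z : (L → Matrix.specialUnitaryGroup n ℂ) × (L → E) =>
      (S (F z.1) - Real.log (J z.1)) + T z.2 := (hSt.comp measurable_fst).add (hT.comp measurable_snd)
  haveI : Fact (Measurable fun z : (L → Matrix.specialUnitaryGroup n ℂ) × (L → E) =>
      (S (F z.1) - Real.log (J z.1)) + T z.2) := ⟨hH⟩
  haveI : IsMarkovKernel (sunLeapfrogHMC ι hι μ T ε hg fun v => S (F v) - Real.log (J v)) := by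
    unfold sunLeapfrogHMC; infer_instance
  haveI : IsProbabilityMeasure ((Measure.pi fun _ : L =>
      haarProbability (Matrix.specialUnitaryGroup n ℂ)).map F) :=
    Measure.isProbabilityMeasure_map F.measurable.aemeasurable
  obtain ⟨k, δ, hδ0, hmin⟩ := sunLeapfrogFTHMC_nHit_minorised ι hι μ (τ := τ) hinj hsurj hε hT hT0 hTle hZ hg hb0 hb
    hS hs hj₁ hJ₁ hJ₂ hJm (F := F)
  haveI : IsMarkovKernel (nHit (conjKernel (sunLeapfrogHMC ι hι μ T ε hg fun v => S (F v) - Real.log (J v)) F) (k + 1)) :=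
    isMarkovKernel_nHit _ _
  have hδ1 : δ ≤ 1 := by
    have h := Measure.le_iff'.1 (hmin (F fun _ => 1)) univ
    rwa [Measure.smul_apply, smul_eq_mul, measure_univ, measure_univ, mul_one] at h
  have hδtop : δ ≠ ⊤ := ne_top_of_le_ne_top ENNReal.one_ne_top hδ1
  refine ⟨k, δ.toReal, ENNReal.toReal_pos hδ0.ne' hδtop,
    ENNReal.toReal_le_of_le_ofReal zero_le_one (by rwa [ENNReal.ofReal_one]), fun μ₀ _ t A => ?_⟩
  exact uniformlyErgodic_of_nHit_minorised hmin (sunLeapfrogFTHMC_invariant_gibbs ι hι μ hg hT hZ hJ hJm hF hS) μ₀ t A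

/-- **The Gibbs law is the unique invariant probability law of the reported FT-HMC kernel** (same
hypotheses). -/
theorem sunLeapfrogFTHMC_invariant_unique [Nonempty n] (hinj : Injective ι)
    (hsurj : ∀ X : Matrix n n ℂ, Xᴴ = -X → X.trace = 0 → X ∈ LinearMap.range ι)
    (hε : 0 < ε) (hT : Measurable T) (hT0 : ∀ p, 0 ≤ T p)
    (hTle : ∀ (R : ℝ) (p : L → E), (∀ l, ‖p l‖ ≤ R) → T p ≤ τ R) (hZ : sunMomentumWeight (L := L) μ T univ ≠ ⊤)
    (hg : Measurable g) {b : ℝ} (hb0 : 0 ≤ b) (hb : ∀ u l, ‖g u l‖ ≤ b)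
    (hS : Measurable S) (hs : ∀ u, |S u| ≤ s)
    (hj₁ : 0 < j₁) (hJ₁ : ∀ v, j₁ ≤ J v) (hJ₂ : ∀ v, J v ≤ j₂) (hJm : Measurable J)
    (hF : HasJacobian (Measure.pi fun _ : L => haarProbability (Matrix.specialUnitaryGroup n ℂ)) F
      fun v => ENNReal.ofReal (J v))
    {π' : Measure (L → Matrix.specialUnitaryGroup n ℂ)} [IsProbabilityMeasure π']
    (hπ' : Invariant (conjKernel (sunLeapfrogHMC ι hι μ T ε hg fun v => S (F v) - Real.log (J v)) F) π') :
    π' = gibbsProbability (Measure.pi fun _ : L => haarProbability (Matrix.specialUnitaryGroup n ℂ))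
      (fun u => Real.exp (-S u)) := by
  obtain ⟨hlo, hhi⟩ := gibbsWeight_pinched (L := L) (n := n) hs
  haveI := isProbabilityMeasure_gibbsProbability
    (μ := Measure.pi fun _ : L => haarProbability (Matrix.specialUnitaryGroup n ℂ)) (Real.exp_pos (-s)) hlo hhi
  haveI := isProbabilityMeasure_sunMomentumLaw (L := L) μ T hT hZ
  have hJ : ∀ v, 0 < J v := fun v => hj₁.trans_le (hJ₁ v)
  have hSt := measurable_modifiedAction (F := F) hS hJm
  haveI : Fact (Measurable fun z : (L → Matrix.specialUnitaryGroup n ℂ) × (L → E) =>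
      (S (F z.1) - Real.log (J z.1)) + T z.2) := ⟨(hSt.comp measurable_fst).add (hT.comp measurable_snd)⟩
  haveI : IsMarkovKernel (sunLeapfrogHMC ι hι μ T ε hg fun v => S (F v) - Real.log (J v)) := by
    unfold sunLeapfrogHMC; infer_instance
  haveI : IsProbabilityMeasure ((Measure.pi fun _ : L =>
      haarProbability (Matrix.specialUnitaryGroup n ℂ)).map F) :=
    Measure.isProbabilityMeasure_map F.measurable.aemeasurable
  obtain ⟨k, δ, hδ0, hmin⟩ := sunLeapfrogFTHMC_nHit_minorised ι hι μ (τ := τ) hinj hsurj hε hT hT0 hTle hZ hg hb0 hb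
    hS hs hj₁ hJ₁ hJ₂ hJm (F := F)
  haveI : IsMarkovKernel (nHit (conjKernel (sunLeapfrogHMC ι hι μ T ε hg fun v => S (F v) - Real.log (J v)) F) (k + 1)) :=
    isMarkovKernel_nHit _ _
  exact invariant_unique_of_minorised hmin hδ0
    (invariant_nHit (sunLeapfrogFTHMC_invariant_gibbs ι hι μ hg hT hZ hJ hJm hF hS) (k + 1)) (invariant_nHit hπ' (k + 1))

end FTHMC

/-! ## §3 The engine's coordinates and kinetic term -/

section Engine

variable (N : ℕ) [NeZero N] {L : Type*} [Fintype L] {ε : ℝ}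
  {g : (L → Matrix.specialUnitaryGroup (Fin N) ℂ) → L → SUNCoords N}
  {S : (L → Matrix.specialUnitaryGroup (Fin N) ℂ) → ℝ} {b s : ℝ}
  {F : (L → Matrix.specialUnitaryGroup (Fin N) ℂ) ≃ᵐ (L → Matrix.specialUnitaryGroup (Fin N) ℂ)}
  {J : (L → Matrix.specialUnitaryGroup (Fin N) ℂ) → ℝ} {j₁ j₂ : ℝ}

/-- **THE ENGINE'S FIELD-TRANSFORMED nstep = 1 HMC ON `SU(N)^links` IS UNIFORMLY ERGODIC** (coordinates
`sunCoordι`, kinetic term `sunKinetic = −Σ tr P²`, refresh `Z⁻¹e^{−T}·addHaar^⊗`): for every `N ≥ 1`,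
`ε > 0`, measurable `|g| ≤ b`, measurable `|S| ≤ s` and every measurable equivalence `F` with
`HasJacobian Haar^⊗ F J`, `0 < j₁ ≤ J ≤ j₂` measurable, the reported chain converges to
`Z_S⁻¹e^{−S}·Haar^⊗` from EVERY initial law: `|μ₀K̃ᵗ(A) − π_S(A)| ≤ (1 − δ)^{⌊t/(k+1)⌋}`. -/
theorem engine_sunLeapfrogFTHMC_uniformlyErgodic (hε : 0 < ε) (hg : Measurable g) (hb0 : 0 ≤ b)
    (hb : ∀ u l, ‖g u l‖ ≤ b) (hS : Measurable S) (hs : ∀ u, |S u| ≤ s)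
    (hj₁ : 0 < j₁) (hJ₁ : ∀ v, j₁ ≤ J v) (hJ₂ : ∀ v, J v ≤ j₂) (hJm : Measurable J)
    (hF : HasJacobian (Measure.pi fun _ : L => haarProbability (Matrix.specialUnitaryGroup (Fin N) ℂ)) F
      fun v => ENNReal.ofReal (J v)) :
    ∃ k : ℕ, ∃ δ : ℝ, 0 < δ ∧ δ ≤ 1 ∧ ∀ (μ₀ : Measure (L → Matrix.specialUnitaryGroup (Fin N) ℂ))
      [IsProbabilityMeasure μ₀] (t : ℕ) (A : Set (L → Matrix.specialUnitaryGroup (Fin N) ℂ)),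
      |((fun m : Measure (L → Matrix.specialUnitaryGroup (Fin N) ℂ) =>
            m.bind (conjKernel (sunLeapfrogHMC (sunCoordι N) (sunCoordι_skew N)
              (Measure.addHaar : Measure (SUNCoords N)) (sunKinetic N) ε hg fun v => S (F v) - Real.log (J v)) F))^[t] μ₀).real A
          - (gibbsProbability (Measure.pi fun _ : L => haarProbability (Matrix.specialUnitaryGroup (Fin N) ℂ))
              (fun u => Real.exp (-S u))).real A| ≤ (1 - δ) ^ (t / (k + 1)) :=
  sunLeapfrogFTHMC_uniformlyErgodic (sunCoordι N) (sunCoordι_skew N) Measure.addHaar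
    (τ := fun R => Fintype.card L * ((N + 4 * Fintype.card (UpperPair N)) * R ^ 2))
    (sunCoordι_injective N) (sunCoordι_range N) hε (measurable_sunKinetic N) (sunKinetic_nonneg N)
    (sunKinetic_le_of_norm_le N) (sunMomentumWeight_sunKinetic_ne_top N Measure.addHaar) hg hb0 hb hS hs
    hj₁ hJ₁ hJ₂ hJm hF

/-- **… and `Z_S⁻¹e^{−S}·Haar^{⊗links}` is the reported chain's ONLY invariant probability law.** -/
theorem engine_sunLeapfrogFTHMC_invariant_unique (hε : 0 < ε) (hg : Measurable g) (hb0 : 0 ≤ b)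
    (hb : ∀ u l, ‖g u l‖ ≤ b) (hS : Measurable S) (hs : ∀ u, |S u| ≤ s)
    (hj₁ : 0 < j₁) (hJ₁ : ∀ v, j₁ ≤ J v) (hJ₂ : ∀ v, J v ≤ j₂) (hJm : Measurable J)
    (hF : HasJacobian (Measure.pi fun _ : L => haarProbability (Matrix.specialUnitaryGroup (Fin N) ℂ)) F
      fun v => ENNReal.ofReal (J v))
    {π' : Measure (L → Matrix.specialUnitaryGroup (Fin N) ℂ)} [IsProbabilityMeasure π']
    (hπ' : Invariant (conjKernel (sunLeapfrogHMC (sunCoordι N) (sunCoordι_skew N)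
      (Measure.addHaar : Measure (SUNCoords N)) (sunKinetic N) ε hg fun v => S (F v) - Real.log (J v)) F) π') :
    π' = gibbsProbability (Measure.pi fun _ : L => haarProbability (Matrix.specialUnitaryGroup (Fin N) ℂ))
      (fun u => Real.exp (-S u)) :=
  sunLeapfrogFTHMC_invariant_unique (sunCoordι N) (sunCoordι_skew N) Measure.addHaar
    (τ := fun R => Fintype.card L * ((N + 4 * Fintype.card (UpperPair N)) * R ^ 2))
    (sunCoordι_injective N) (sunCoordι_range N) hε (measurable_sunKinetic N) (sunKinetic_nonneg N)
    (sunKinetic_le_of_norm_le N) (sunMomentumWeight_sunKinetic_ne_top N Measure.addHaar) hg hb0 hb hS hs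
    hj₁ hJ₁ hJ₂ hJm hF hπ'

end Engine

end Summit.Ventures.LatticeQCDFlow.Exactness
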